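import Summits.CriticalPhenomena.PercolationContinuityZ3.Theorems.PercNearOneGluingNoHeavyLowerTailSahiMixtureLaw
import Literature.Combinatorics.Sahi2008.SetPartitionForm
import Literature.Combinatorics.Sahi2008.TotalOrder
import HarnessLib

/-!
# Events whose mixed moments are monotone mixtures of products are Sahi-positive at every order;
# so is their all-members OR-coin cell

Support file of the one-cut programme (crux `NoHeavyLowerTail`, stmt-CriticalPhenomena-4575; cell `prim-masterthm`, seat P3, gen 15;
`run/shared/lean/prim/prim-masterthm/prim-masterthm-p3/HIERARCHY.md` §23; memo
`run/shared/lean/prim/prim-masterthm/FROM-prim-masterthm-p3-g15-MONOTONE-MIXTURES.md`).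

THE HYPOTHESIS (`chain moments`).  Events `A_0,…,A_{n−1}` of a finite probability space whose moments over DISTINCT indices factor along a chain:
there are level weights `w_l ≥ 0` (`l < L`, `Σ w = 1`) and numbers `y_{l,i} ≥ 0`, nondecreasing in the level `l` for each `i`, with
`E[Π_{r<k} 1_{A_{e r}}] = Σ_l w_l Π_{r<k} y_{l, e r}` for every injective `e : Fin k → Fin n`.  This is exactly the moment structure of events that are
CONDITIONALLY INDEPENDENT given a latent level, with co-monotone conditional probabilities — monotone mixtures of product measures (one-factor
threshold models; de Finetti exchangeable laws when `y_{l,i}` does not depend on `i`; nested events when `y ∈ {0,1}`); by the Karlin–Rinott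
composition theorem such laws satisfy the FKG lattice condition, so what follows is the case "distinct coordinate events of a monotone mixture of
product measures" of Sahi's Conjecture 5 — settled here at EVERY order.  The concrete mixture weight and the verification of the hypothesis for it
are in the companion file `…SahiMixtureMonotone.lean`; this file is definition-free.

THE THEOREMS (uniform in the order; everything PROVED, standard axioms).
* `sahiE_congr_of_moments` — `E_n` depends on the family only through the expectations of products over injectively enumerated sub-tuples of slots
  (Sahi's set-partition form (7), the tree's `Sahi2008.sahiE_eq_sahiESetPartition`): the transfer lemma.
* **`sahiE_nonneg_of_chainMoments`** — under the hypothesis, `E_n(1_{A_0},…,1_{A_{n−1}}) ≥ 0`, for every `n`.  Proof: transfer to the monotone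
  nonnegative functions `l ↦ y_{l,j}` on the CHAIN `Fin L` under the weight `w`, then Blinovsky's Lemma 1 (the tree's `sahiPositive_of_linearOrder`).
  Sub-families: `sahiE_nonneg_of_chainMoments_sub`.
* **`sahiE_orCoin_all_nonneg_of_chainMoments`** — OR-ing an independent coin of bias `h ∈ [0,1]` into ALL members keeps `E_m ≥ 0` for every `m`
  and every `m` distinct members (the coin is a new top level `y ≡ 1` of weight `h` above the chain, `Fin.snoc`): the value form of the TOP rung of the
  H-MIX ladder on this class at every order, with the hypothesis `E_m ≥ 0` of `TopRowConjecture` automatically satisfied.  (The memo proves more on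
  paper — Bernstein positivity of the cell, from the pointwise nonnegativity of the `m`-copy kernel on nested hold-sets — not formalised here.)
HONEST FRAMING: nothing here asserts (M⁺-k) or `C_k` for `k ≥ 3`; general increasing events of these laws, and overlapping intersections of the
`A_i`, are NOT covered. [this work]
-/

noncomputable section

open scoped Classical

namespace Summit.CriticalPhenomena.PercolationContinuityZ3.Theorems

open Finset Function
open Literature.Combinatorics.Sahi2008
open Literature.Probability.Percolation.DecisionTree (ind ind_of_mem ind_of_not_mem ind_nonneg)

namespace SahiMixture

/-! ### `E_n` is determined by the sub-tuple moments -/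

/-- **Moment transfer.**  If two families (possibly on different finite weighted types) have the same expectation of the product over every
injectively indexed sub-tuple of slots, they have the same `E_n` (Sahi's set-partition form (7): every block of a set partition is enumerated
injectively by `OrderedFinpartition.emb`). [this work] -/
theorem sahiE_congr_of_moments {α β : Type*} [Fintype α] [Fintype β] (μ : α → ℝ) (ν : β → ℝ) {n : ℕ}
    (f : Fin n → α → ℝ) (g : Fin n → β → ℝ)
    (h : ∀ (k : ℕ) (e : Fin k → Fin n), Function.Injective e → ex μ (∏ r, f (e r)) = ex ν (∏ r, g (e r))) :
    sahiE μ n f = sahiE ν n g := by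
  rcases n with _ | n
  · rw [sahiE_zero, sahiE_zero]
  · rw [sahiE_eq_sahiESetPartition, sahiE_eq_sahiESetPartition]
    unfold sahiESetPartition
    refine Finset.sum_congr rfl fun c _ => ?_
    congr 1
    refine Finset.prod_congr rfl fun m _ => ?_
    rw [h _ (c.emb m) (c.emb_strictMono m).injective]

/-! ### Chain moments ⇒ Sahi positivity of every order -/

section Chain

variable {α : Type*} [Fintype α] {L n : ℕ}

/-- **Sahi positivity of every order from chain moments.**  If the moments of the distinct-index products of `1_{A_0},…,1_{A_{n−1}}` are the
`w`-mixture (`w ≥ 0`, mass `1`) of the products of nonnegative numbers `y_{l,i}` nondecreasing in the level `l`, then `E_n(1_{A_0},…,1_{A_{n−1}}) ≥ 0`.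
Conditionally independent events with co-monotone conditional probabilities satisfy the hypothesis; the conclusion holds for every `n`. [this work] -/
theorem sahiE_nonneg_of_chainMoments (μ : α → ℝ) (A : Fin n → Set α) (w : Fin L → ℝ) (hw0 : ∀ l, 0 ≤ w l) (hw1 : ∑ l, w l = 1)
    (y : Fin L → Fin n → ℝ) (hy0 : ∀ l i, 0 ≤ y l i) (hmono : ∀ i, Monotone (fun l => y l i))
    (hmom : ∀ (k : ℕ) (e : Fin k → Fin n), Function.Injective e →
      ex μ (∏ r, ind (A (e r))) = ∑ l, w l * ∏ r, y l (e r)) :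
    0 ≤ sahiE μ n (fun j => ind (A j)) := by
  rw [sahiE_congr_of_moments μ w (fun j => ind (A j)) (fun j l => y l j) ?_]
  · exact sahiPositive_of_linearOrder hw0 hw1 n _ (fun j l => hy0 l j) (fun j => hmono j)
  · intro k e he
    rw [hmom k e he, ex_def]
    refine Finset.sum_congr rfl fun l _ => ?_
    rw [Finset.prod_apply]

/-- **Sub-families.**  Under the same hypothesis every injectively indexed sub-family is again of the same kind, so `E_m(1_{A_{s 0}},…,1_{A_{s(m−1)}}) ≥ 0`
for every `m` and every injective `s : Fin m → Fin n`. [this work] -/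
theorem sahiE_nonneg_of_chainMoments_sub (μ : α → ℝ) (A : Fin n → Set α) (w : Fin L → ℝ) (hw0 : ∀ l, 0 ≤ w l) (hw1 : ∑ l, w l = 1)
    (y : Fin L → Fin n → ℝ) (hy0 : ∀ l i, 0 ≤ y l i) (hmono : ∀ i, Monotone (fun l => y l i))
    (hmom : ∀ (k : ℕ) (e : Fin k → Fin n), Function.Injective e →
      ex μ (∏ r, ind (A (e r))) = ∑ l, w l * ∏ r, y l (e r))
    {m : ℕ} (s : Fin m → Fin n) (hs : Function.Injective s) :
    0 ≤ sahiE μ m (fun j => ind (A (s j))) :=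
  sahiE_nonneg_of_chainMoments μ (A ∘ s) w hw0 hw1 (fun l j => y l (s j)) (fun l j => hy0 l (s j)) (fun j => hmono (s j))
    fun k e he => hmom k (s ∘ e) (hs.comp he)

/-! ### The all-members OR-coin cell, every order -/

/-- Appending a top value to a monotone sequence bounded by it keeps it monotone (plumbing for the coin level). [folklore] -/
theorem monotone_snoc_of_le {f : Fin L → ℝ} (hf : Monotone f) {x : ℝ} (hfx : ∀ l, f l ≤ x) :
    Monotone (Fin.snoc f x : Fin (L + 1) → ℝ) := by
  intro a b hab
  rcases Fin.eq_castSucc_or_eq_last a with ⟨a', rfl⟩ | rfl <;>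
    rcases Fin.eq_castSucc_or_eq_last b with ⟨b', rfl⟩ | rfl
  · simp only [Fin.snoc_castSucc]
    exact hf (Fin.castSucc_le_castSucc_iff.1 hab)
  · simp only [Fin.snoc_castSucc, Fin.snoc_last]
    exact hfx a'
  · exfalso
    exact absurd hab (not_le.2 (Fin.castSucc_lt_last b'))
  · exact le_rfl

/-- Moments of the all-members OR-coin family under `μ ⊗ coin(h)`: `E[Π_r 1_{A_{e r} ∪ H}] = (1 − h)·E[Π_r 1_{A_{e r}}] + h`. [this work] -/
theorem ex_coinWeight_prod_ind_orCoin_all (μ : α → ℝ) (hμ1 : ∑ a, μ a = 1) (A : Fin n → Set α) (h : ℝ) {k : ℕ}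
    (e : Fin k → Fin n) :
    ex (coinWeight μ h) (∏ r, ind (orCoin (A (e r)) true)) = (1 - h) * ex μ (∏ r, ind (A (e r))) + h := by
  rw [ex_coinWeight]
  have hf : (fun a : α => (∏ r, ind (orCoin (A (e r)) true)) (a, false)) = ∏ r, ind (A (e r)) := by
    funext a
    rw [Finset.prod_apply, Finset.prod_apply]
    exact Finset.prod_congr rfl fun r _ => ind_orCoin_false _ _ _
  have ht : (fun a : α => (∏ r, ind (orCoin (A (e r)) true)) (a, true)) = fun _ => 1 := by
    funext a
    rw [Finset.prod_apply]
    exact Finset.prod_eq_one fun r _ => by rw [ind_orCoin_true]; rfl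
  rw [hf, ht, ex_const hμ1, mul_one]

/-- **The all-members OR-coin cell is nonnegative at every order under chain moments.**  With `0 ≤ y ≤ 1` (so that the coin, a new top level
`y ≡ 1` of weight `h`, keeps the levels co-monotone), for `h ∈ [0,1]`, every `m` and every injective `s : Fin m → Fin n`:
`E_m(μ ⊗ coin(h); 1_{A_{s 0} ∪ H},…,1_{A_{s(m−1)} ∪ H}) ≥ 0`.  The value form of the TOP rung of the H-MIX ladder on this class, uniformly in `m`.
[this work] -/
theorem sahiE_orCoin_all_nonneg_of_chainMoments (μ : α → ℝ) (hμ1 : ∑ a, μ a = 1) (A : Fin n → Set α)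
    (w : Fin L → ℝ) (hw0 : ∀ l, 0 ≤ w l) (hw1 : ∑ l, w l = 1)
    (y : Fin L → Fin n → ℝ) (hy0 : ∀ l i, 0 ≤ y l i) (hy1 : ∀ l i, y l i ≤ 1) (hmono : ∀ i, Monotone (fun l => y l i))
    (hmom : ∀ (k : ℕ) (e : Fin k → Fin n), Function.Injective e →
      ex μ (∏ r, ind (A (e r))) = ∑ l, w l * ∏ r, y l (e r))
    {h : ℝ} (h0 : 0 ≤ h) (h1 : h ≤ 1) {m : ℕ} (s : Fin m → Fin n) (hs : Function.Injective s) :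
    0 ≤ sahiE (coinWeight μ h) m (fun j => ind (orCoin (A (s j)) true)) := by
  -- the extended chain `Fin (L+1)`: the levels of `w` scaled by `1 − h`, plus a top level of weight `h` where every `y` is `1`
  refine sahiE_nonneg_of_chainMoments (coinWeight μ h) (fun j => orCoin (A (s j)) true)
    (Fin.snoc (fun l => (1 - h) * w l) h) ?_ ?_ (fun a j => (Fin.snoc (fun l => y l (s j)) 1 : Fin (L + 1) → ℝ) a) ?_ ?_ ?_
  · intro a
    rcases Fin.eq_castSucc_or_eq_last a with ⟨a', rfl⟩ | rfl
    · simp only [Fin.snoc_castSucc]; exact mul_nonneg (sub_nonneg.2 h1) (hw0 a')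
    · simp only [Fin.snoc_last]; exact h0
  · simp only [Fin.sum_univ_castSucc, Fin.snoc_castSucc, Fin.snoc_last, ← Finset.mul_sum, hw1]; ring
  · intro a j
    rcases Fin.eq_castSucc_or_eq_last a with ⟨a', rfl⟩ | rfl
    · simp only [Fin.snoc_castSucc]; exact hy0 a' (s j)
    · simp only [Fin.snoc_last]; exact zero_le_one
  · exact fun j => monotone_snoc_of_le (hmono (s j)) fun l => hy1 l (s j)
  · intro k e he
    rw [show (∏ r, ind (orCoin (A (s (e r))) true)) = ∏ r, ind (orCoin (A ((s ∘ e) r)) true) from rfl,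
      ex_coinWeight_prod_ind_orCoin_all μ hμ1 A h (s ∘ e), hmom k (s ∘ e) (hs.comp he), Fin.sum_univ_castSucc]
    simp only [Fin.snoc_castSucc, Fin.snoc_last, Function.comp, Finset.prod_const_one, mul_one, Finset.mul_sum]
    congr 1
    refine Finset.sum_congr rfl fun l _ => ?_
    ring

end Chain

end SahiMixture

end Summit.CriticalPhenomena.PercolationContinuityZ3.Theorems

end
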